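import Summits.CriticalPhenomena.SAWScalingLimit.Theorems.SAWDefectDecoherenceBoundaryClosureRSidePhaseCornerBaseThree
import Summits.CriticalPhenomena.SAWScalingLimit.Theorems.SAWDefectDecoherenceBoundaryClosureRSidePhaseCornerBaseTwo
import Summits.CriticalPhenomena.SAWScalingLimit.Theorems.SAWDefectDecoherenceBoundaryClosureRInnerPolygonsHalfLattice
import HarnessLib

/-!
# Crux `BoundaryClosureR` (stmt-CriticalPhenomena-14004), line `polygon-parity-squeeze`:
# the corner phase relation `sidePhase_corner` (sub-goal (A1b') of `stub_polygonIdentification`,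
# companion of `sidePhase_flat`)

At an exact LATTICE CORNER of a simply connected hexagonal domain `Λ` (inside `ball x r`, `Λ` is
the intersection = convex corner, or the union = reflex corner, of two exact zigzag half-lattices
`{n ≤ zigzagForm k}`, `{n' ≤ zigzagForm k'}` with non-parallel normals, the corner face lying in
`ball x (r - 7)`), off the root dart `a = {u, w}` (midpoint outside `ball x r`), the boundary darts
`e` of the form-`k` class (heading `-(1/√3)·n_k`) and `e'` of the form-`k'` class with midpoints in
`ball x (r - 4)` carry phases differing by the turning of the boundary at the corner:

  `F(e')·|F₀(e)| = e^{-i(5/8)·T} F(e)·|F₀(e')|`,   `T = arg (n_{k'} / n_k) ∈ {±π/3, ±2π/3}`.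

Proof.  The pairs `(0,3)` and `(0,2)` are `sidePhaseCorner_base_three`, `sidePhaseCorner_base_two`
(transfer along the floor, corner step, transfer along the column; winding rigidity).  The face
rotation `σ = hexRot60` (centres multiplied by `ζ = e^{iπ/3}`) carries the half-lattice of form `k`
to the one of form `ρ k`, `ρ = (3,2,4,5,0,1)`, up to a threshold shift (`zigzagForm_rot`), and
`n_{ρ k} = ζ·n_k` (`innerNormal_rot`); the observable is `σ`-invariant
(`InteriorFlattening.Liouville.Transport`), so the relation for `(ρ k, ρ k')` gives it for
`(k, k')` (`transport`), and swapping the two classes conjugates the phase (`swap`,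
`arg (n_k/n_{k'}) = -arg (n_{k'}/n_k)` as `n_{k'} ≠ -n_k`).  Since `ρ` is a `6`-cycle, the orbits
of `(0,3)`, `(0,2)` and of their swaps exhaust the `24` admissible pairs.

Remark.  The hypothesis on the corner face cannot be dropped: if the corner lies outside the
ball and the root sits on the boundary arc joining the two sides through the corner, the
windings to the two classes differ by `T ∓ 2π` and the relation fails (e.g. the `60°` wedge
`{0 ≤ zigzagForm 3} ∩ {0 ≤ zigzagForm 4}` truncated at radius `70`, `x = 24i`, `r = 20`, root
`{(0,-1;0), (0,-1;1)}` at the apex).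

Sources: H. Duminil-Copin, S. Smirnov, Ann. of Math. 175 (2012), §3 (the winding of walks to the
boundary is rigid).  No definition is introduced.
-/

noncomputable section

open scoped BigOperators Topology
open Filter Set Metric Complex
open Literature.Probability.LatticeModels Literature.Probability.RandomPlanarGeometry
open Literature.Probability.RandomPlanarGeometry.SAW
open Summit.CriticalPhenomena.SAWScalingLimit.Theorems.PickHalfPlane
open Summit.CriticalPhenomena.SAWScalingLimit.Theorems.ObservableToSLER.BridgeGate (hexRot60 hexRotIso
  hexRotIso_succ_apply hexRotIso_zero_apply hexCenter_hexRotIso norm_triZeta_pow triZeta_pow_ne_zero)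
open Summit.CriticalPhenomena.SAWScalingLimit.Theorems.InteriorFlattening.Liouville.Transport

namespace Summit.CriticalPhenomena.SAWScalingLimit.Theorems.PolygonParitySqueeze

namespace SidePhaseCorner

/-! ### 1. The face rotation on the six forms and the six normals -/

/-- **Rotation table of the forms**: `zigzagForm (ρ k) (σ v) = zigzagForm k v + s k` with
`ρ = (3,2,4,5,0,1)`, `s = (1,-1,0,0,0,0)` (`σ = hexRot60`). [folklore] -/
theorem zigzagForm_rot (k : Fin 6) (v : HexVertex) :
    zigzagForm ((![3, 2, 4, 5, 0, 1] : Fin 6 → Fin 6) k) (hexRot60 v) = zigzagForm k v + (![1, -1, 0, 0, 0, 0] : Fin 6 → ℤ) k := by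
  obtain ⟨y, t⟩ := v
  fin_cases k <;> fin_cases t <;> simp [zigzagForm, hexRot60] <;> ring

/-- **Rotation table of the normals**: `n_{ρ k} = ζ · n_k`. [folklore] -/
theorem innerNormal_rot (k : Fin 6) : innerNormal ((![3, 2, 4, 5, 0, 1] : Fin 6 → Fin 6) k) = triZeta * innerNormal k := by
  have h3 : Real.sqrt 3 * Real.sqrt 3 = 3 := Real.mul_self_sqrt (by norm_num)
  fin_cases k <;> rw [innerNormal_eq, triZeta_eq] <;> apply Complex.ext <;> simp <;> nlinarith [h3]

/-! ### 2. Transport of the corner relation along the face rotation -/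

/-- **Transport.** The corner phase relation for the pair of forms `(ρ k, ρ k')` implies the one
for `(k, k')`: push the configuration forward by `σ` (domain, root, thresholds shifted by `s`,
centre `ζ x`, darts), apply the relation there, and pull the observables back
(`hexParafermionicObservable_image_mk`); `arg (n_{ρ k'}/n_{ρ k}) = arg (n_{k'}/n_k)`.
[cite: DuminilCopinSmirnov2012, §3 (winding of walks to the boundary)] -/
theorem transport {k k' : Fin 6} (IH : ∀ (Λ : Finset HexVertex), hexDomainSimplyConnected Λ → ∀ (u w : HexVertex), hexGraph.Adj u w → u ∉ Λ → w ∈ Λ → ∀ (n n' : ℤ) (x : ℂ) (r : ℝ), innerNormal ((![3, 2, 4, 5, 0, 1] : Fin 6 → Fin 6) k') ≠ innerNormal ((![3, 2, 4, 5, 0, 1] : Fin 6 → Fin 6) k) → innerNormal ((![3, 2, 4, 5, 0, 1] : Fin 6 → Fin 6) k') ≠ -innerNormal ((![3, 2, 4, 5, 0, 1] : Fin 6 → Fin 6) k) → ((∀ v : HexVertex, hexCenter v ∈ Metric.ball x r → (v ∈ Λ ↔ (n ≤ zigzagForm ((![3, 2, 4, 5, 0, 1] : Fin 6 → Fin 6)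 k) v ∧ n' ≤ zigzagForm ((![3, 2, 4, 5, 0, 1] : Fin 6 → Fin 6) k') v))) ∨ (∀ v : HexVertex, hexCenter v ∈ Metric.ball x r → (v ∈ Λ ↔ (n ≤ zigzagForm ((![3, 2, 4, 5, 0, 1] : Fin 6 → Fin 6) k) v ∨ n' ≤ zigzagForm ((![3, 2, 4, 5, 0, 1] : Fin 6 → Fin 6) k') v)))) → (∃ v₀ : HexVertex, hexCenter v₀ ∈ Metric.ball x (r - 7) ∧ zigzagForm ((![3, 2, 4, 5, 0, 1] : Fin 6 → Fin 6) k) v₀ = n ∧ zigzagForm ((![3, 2, 4, 5, 0, 1] : Fin 6 → Fin 6) k') v₀ = n') → hexMidpoint s(u, w) ∉ Metric.ball x r → ∀ (v t v' t' : HexVertex), v ∈ Λ → t ∉ Λ → hexGraph.Adj v t → v' ∈ Λ → t' ∉ Λ → hexGraph.Adj v' t' → hexCenter t - hexCenter v = -((1 / Real.sqrt 3 : ℝ) : ℂ) * innerNormal ((![3, 2, 4, 5, 0, 1] : Fin 6 → Fin 6) k) → hexCenter t' - hexCenter v' = -((1 / Real.sqrt 3 : ℝ) : ℂ) * innerNormal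 ((![3, 2, 4, 5, 0, 1] : Fin 6 → Fin 6) k') → hexMidpoint s(v, t) ∈ Metric.ball x (r - 4) → hexMidpoint s(v', t') ∈ Metric.ball x (r - 4) → hexParafermionicObservable Λ s(u, w) hexCriticalFugacity (5 / 8) s(v', t') * ((‖hexParafermionicObservable Λ s(u, w) hexCriticalFugacity 0 s(v, t)‖ : ℝ) : ℂ) = Complex.exp (-(5 / 8 : ℂ) * (Complex.arg (innerNormal ((![3, 2, 4, 5, 0, 1] : Fin 6 → Fin 6) k') / innerNormal ((![3, 2, 4, 5, 0, 1] : Fin 6 → Fin 6) k)) : ℂ) * Complex.I) * hexParafermionicObservable Λ s(u, w) hexCriticalFugacity (5 / 8) s(v, t) * ((‖hexParafermionicObservable Λ s(u, w) hexCriticalFugacity 0 s(v', t')‖ : ℝ) : ℂ)) : ∀ (Λ : Finset HexVertex), hexDomainSimplyConnected Λ → ∀ (u w : HexVertex), hexGraph.Adj u w → u ∉ Λ → w ∈ Λ → ∀ (n n' : ℤ) (x : ℂ) (r : ℝ), innerNormal k' ≠ innerNormal k → innerNormal k' ≠ -innerNormal k → ((∀ v : HexVertex, hexCenter v ∈ Metric.ball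 x r → (v ∈ Λ ↔ (n ≤ zigzagForm k v ∧ n' ≤ zigzagForm k' v))) ∨ (∀ v : HexVertex, hexCenter v ∈ Metric.ball x r → (v ∈ Λ ↔ (n ≤ zigzagForm k v ∨ n' ≤ zigzagForm k' v)))) → (∃ v₀ : HexVertex, hexCenter v₀ ∈ Metric.ball x (r - 7) ∧ zigzagForm k v₀ = n ∧ zigzagForm k' v₀ = n') → hexMidpoint s(u, w) ∉ Metric.ball x r → ∀ (v t v' t' : HexVertex), v ∈ Λ → t ∉ Λ → hexGraph.Adj v t → v' ∈ Λ → t' ∉ Λ → hexGraph.Adj v' t' → hexCenter t - hexCenter v = -((1 / Real.sqrt 3 : ℝ) : ℂ) * innerNormal k → hexCenter t' - hexCenter v' = -((1 / Real.sqrt 3 : ℝ) : ℂ) * innerNormal k' → hexMidpoint s(v, t) ∈ Metric.ball x (r - 4) → hexMidpoint s(v', t') ∈ Metric.ball x (r - 4) → hexParafermionicObservable Λ s(u, w) hexCriticalFugacity (5 / 8) s(v', t') * ((‖hexParafermionicObservable Λ s(u, w) hexCriticalFugacity 0 s(v, t)‖ : ℝ) : ℂ) = Complex.exp (-(5 / 8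 : ℂ) * (Complex.arg (innerNormal k' / innerNormal k) : ℂ) * Complex.I) * hexParafermionicObservable Λ s(u, w) hexCriticalFugacity (5 / 8) s(v, t) * ((‖hexParafermionicObservable Λ s(u, w) hexCriticalFugacity 0 s(v', t')‖ : ℝ) : ℂ) := by
  intro Λ hΛ u w huw hu hw n n' x r hne hne' hpin hapex hroot v t v' t' hv ht hvt hv' ht' hvt' hdir hdir'
    heb heb'
  -- the rotation `σ`, acting by `z ↦ ζ z`
  have hS : ∀ f : HexVertex, hexCenter (hexRotIso 1 f) = triZeta * hexCenter f + 0 := fun f => by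
    rw [hexCenter_hexRotIso, pow_one, add_zero]
  have hS1 : ∀ f : HexVertex, hexRotIso 1 f = hexRot60 f := fun f => rfl
  have hζ0 : triZeta ≠ 0 := by simpa using triZeta_pow_ne_zero 1
  have hζ1 : ‖triZeta‖ = 1 := by simpa using norm_triZeta_pow 1
  have hdist : ∀ z y : ℂ, dist (triZeta * z + 0) (triZeta * y) = dist z y := fun z y => by
    rw [add_zero, Complex.dist_eq, ← mul_sub, norm_mul, hζ1, one_mul, Complex.dist_eq]
  have hform : ∀ (l : Fin 6) (f : HexVertex),
      zigzagForm ((![3, 2, 4, 5, 0, 1] : Fin 6 → Fin 6) l) (hexRotIso 1 f) = zigzagForm l f + (![1, -1, 0, 0, 0, 0] : Fin 6 → ℤ) l := fun l f => by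
    rw [hS1, zigzagForm_rot]
  have hform' : ∀ (l : Fin 6) (f : HexVertex),
      zigzagForm ((![3, 2, 4, 5, 0, 1] : Fin 6 → Fin 6) l) f = zigzagForm l ((hexRotIso 1).symm f) + (![1, -1, 0, 0, 0, 0] : Fin 6 → ℤ) l := fun l f => by
    conv_lhs => rw [← RelIso.apply_symm_apply (hexRotIso 1) f]
    exact hform l _
  -- the transported data
  have hΛ' : hexDomainSimplyConnected (Λ.image (hexRotIso 1)) :=
    (hexDomainSimplyConnected_image_iff _ Λ).2 hΛ
  have huw' : hexGraph.Adj (hexRotIso 1 u) (hexRotIso 1 w) := (RelIso.map_rel_iff _).2 huw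
  have hmem : ∀ {f : HexVertex}, hexRotIso 1 f ∈ Λ.image (hexRotIso 1) ↔ f ∈ Λ := fun {f} =>
    (RelIso.injective _).mem_finset_image
  have hne₂ : innerNormal ((![3, 2, 4, 5, 0, 1] : Fin 6 → Fin 6) k') ≠ innerNormal ((![3, 2, 4, 5, 0, 1] : Fin 6 → Fin 6) k) := by
    rw [innerNormal_rot, innerNormal_rot]
    exact fun h => hne (mul_left_cancel₀ hζ0 h)
  have hne₂' : innerNormal ((![3, 2, 4, 5, 0, 1] : Fin 6 → Fin 6) k') ≠ -innerNormal ((![3, 2, 4, 5, 0, 1] : Fin 6 → Fin 6) k) := by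
    rw [innerNormal_rot, innerNormal_rot, ← mul_neg]
    exact fun h => hne' (mul_left_cancel₀ hζ0 h)
  have hpin₂ : (∀ f : HexVertex, hexCenter f ∈ Metric.ball (triZeta * x) r →
      (f ∈ Λ.image (hexRotIso 1) ↔ (n + (![1, -1, 0, 0, 0, 0] : Fin 6 → ℤ) k ≤ zigzagForm ((![3, 2, 4, 5, 0, 1] : Fin 6 → Fin 6) k) f ∧
        n' + (![1, -1, 0, 0, 0, 0] : Fin 6 → ℤ) k' ≤ zigzagForm ((![3, 2, 4, 5, 0, 1] : Fin 6 → Fin 6) k') f))) ∨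
      (∀ f : HexVertex, hexCenter f ∈ Metric.ball (triZeta * x) r →
      (f ∈ Λ.image (hexRotIso 1) ↔ (n + (![1, -1, 0, 0, 0, 0] : Fin 6 → ℤ) k ≤ zigzagForm ((![3, 2, 4, 5, 0, 1] : Fin 6 → Fin 6) k) f ∨
        n' + (![1, -1, 0, 0, 0, 0] : Fin 6 → ℤ) k' ≤ zigzagForm ((![3, 2, 4, 5, 0, 1] : Fin 6 → Fin 6) k') f))) := by
    have hc : ∀ f : HexVertex, hexCenter f ∈ Metric.ball (triZeta * x) r →
        hexCenter ((hexRotIso 1).symm f) ∈ Metric.ball x r := by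
      intro f hf
      have e : hexCenter f = triZeta * hexCenter ((hexRotIso 1).symm f) + 0 := by
        rw [← hS, RelIso.apply_symm_apply]
      rwa [e, Metric.mem_ball, hdist, ← Metric.mem_ball] at hf
    rcases hpin with hpin | hpin
    · left
      intro f hf
      rw [mem_image_iff, hpin _ (hc f hf), hform' k f, hform' k' f]
      omega
    · right
      intro f hf
      rw [mem_image_iff, hpin _ (hc f hf), hform' k f, hform' k' f]
      omega
  have hapex₂ : ∃ v₀ : HexVertex, hexCenter v₀ ∈ Metric.ball (triZeta * x) (r - 7) ∧
      zigzagForm ((![3, 2, 4, 5, 0, 1] : Fin 6 → Fin 6) k) v₀ = n + (![1, -1, 0, 0, 0, 0] : Fin 6 → ℤ) k ∧ zigzagForm ((![3, 2, 4, 5, 0, 1] : Fin 6 → Fin 6) k') v₀ = n' + (![1, -1, 0, 0, 0, 0] : Fin 6 → ℤ) k' := by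
    obtain ⟨v₀, hv₀, h1, h2⟩ := hapex
    refine ⟨hexRotIso 1 v₀, ?_, by rw [hform, h1], by rw [hform, h2]⟩
    rwa [hS, Metric.mem_ball, hdist, ← Metric.mem_ball]
  have hroot₂ : hexMidpoint s(hexRotIso 1 u, hexRotIso 1 w) ∉ Metric.ball (triZeta * x) r := by
    intro h
    rw [← Sym2.map_mk, hexMidpoint_map _ hS, Metric.mem_ball, hdist, ← Metric.mem_ball] at h
    exact hroot h
  have hdir₂ : ∀ {a b : HexVertex} {l : Fin 6},
      hexCenter b - hexCenter a = -((1 / Real.sqrt 3 : ℝ) : ℂ) * innerNormal l →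
      hexCenter (hexRotIso 1 b) - hexCenter (hexRotIso 1 a) =
        -((1 / Real.sqrt 3 : ℝ) : ℂ) * innerNormal ((![3, 2, 4, 5, 0, 1] : Fin 6 → Fin 6) l) := by
    intro a b l h
    rw [hS, hS, innerNormal_rot, show triZeta * hexCenter b + 0 - (triZeta * hexCenter a + 0) =
      triZeta * (hexCenter b - hexCenter a) by ring, h]
    ring
  have hball₂ : ∀ {a b : HexVertex}, hexMidpoint s(a, b) ∈ Metric.ball x (r - 4) →
      hexMidpoint s(hexRotIso 1 a, hexRotIso 1 b) ∈ Metric.ball (triZeta * x) (r - 4) := by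
    intro a b h
    rwa [← Sym2.map_mk, hexMidpoint_map _ hS, Metric.mem_ball, hdist, ← Metric.mem_ball]
  -- the relation in the image, pulled back
  have key := IH (Λ.image (hexRotIso 1)) hΛ' (hexRotIso 1 u) (hexRotIso 1 w) huw'
    (fun h => hu (hmem.1 h)) (hmem.2 hw) (n + (![1, -1, 0, 0, 0, 0] : Fin 6 → ℤ) k) (n' + (![1, -1, 0, 0, 0, 0] : Fin 6 → ℤ) k') (triZeta * x) r hne₂ hne₂' hpin₂
    hapex₂ hroot₂ (hexRotIso 1 v) (hexRotIso 1 t) (hexRotIso 1 v') (hexRotIso 1 t') (hmem.2 hv)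
    (fun h => ht (hmem.1 h)) ((RelIso.map_rel_iff _).2 hvt) (hmem.2 hv') (fun h => ht' (hmem.1 h))
    ((RelIso.map_rel_iff _).2 hvt') (hdir₂ hdir) (hdir₂ hdir') (hball₂ heb) (hball₂ heb')
  rw [← Sym2.map_mk, hexParafermionicObservable_image_mk _ hζ0 hS,
    hexParafermionicObservable_image_mk _ hζ0 hS, hexParafermionicObservable_image_mk _ hζ0 hS,
    hexParafermionicObservable_image_mk _ hζ0 hS, innerNormal_rot, innerNormal_rot,
    mul_div_mul_left _ _ hζ0] at key
  exact key

/-! ### 3. Swapping the two classes -/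

/-- **Swap.** The corner phase relation for `(k', k)` implies the one for `(k, k')`: the phase
`e^{-i(5/8)·arg(n_k/n_{k'})}` is the inverse of `e^{-i(5/8)·arg(n_{k'}/n_k)}` because
`n_{k'}/n_k` is a unit complex number other than `-1`. [folklore] -/
theorem swap {k k' : Fin 6} (IH : ∀ (Λ : Finset HexVertex), hexDomainSimplyConnected Λ → ∀ (u w : HexVertex), hexGraph.Adj u w → u ∉ Λ → w ∈ Λ → ∀ (n n' : ℤ) (x : ℂ) (r : ℝ), innerNormal k ≠ innerNormal k' → innerNormal k ≠ -innerNormal k' → ((∀ v : HexVertex, hexCenter v ∈ Metric.ball x r → (v ∈ Λ ↔ (n ≤ zigzagForm k' v ∧ n' ≤ zigzagForm k v))) ∨ (∀ v : HexVertex, hexCenter v ∈ Metric.ball x r → (v ∈ Λ ↔ (n ≤ zigzagForm k' v ∨ n' ≤ zigzagForm k v)))) → (∃ v₀ : HexVertex, hexCenter v₀ ∈ Metric.ball x (r - 7) ∧ zigzagForm k' v₀ = n ∧ zigzagForm k v₀ = n') → hexMidpoint s(u, w) ∉ Metric.ball x r → ∀ (v t v' t' : HexVertex), v ∈ Λ →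 t ∉ Λ → hexGraph.Adj v t → v' ∈ Λ → t' ∉ Λ → hexGraph.Adj v' t' → hexCenter t - hexCenter v = -((1 / Real.sqrt 3 : ℝ) : ℂ) * innerNormal k' → hexCenter t' - hexCenter v' = -((1 / Real.sqrt 3 : ℝ) : ℂ) * innerNormal k → hexMidpoint s(v, t) ∈ Metric.ball x (r - 4) → hexMidpoint s(v', t') ∈ Metric.ball x (r - 4) → hexParafermionicObservable Λ s(u, w) hexCriticalFugacity (5 / 8) s(v', t') * ((‖hexParafermionicObservable Λ s(u, w) hexCriticalFugacity 0 s(v, t)‖ : ℝ) : ℂ) = Complex.exp (-(5 / 8 : ℂ) * (Complex.arg (innerNormal k / innerNormal k') : ℂ) * Complex.I) * hexParafermionicObservable Λ s(u, w) hexCriticalFugacity (5 / 8) s(v, t) * ((‖hexParafermionicObservable Λ s(u, w) hexCriticalFugacity 0 s(v', t')‖ : ℝ) : ℂ)) : ∀ (Λ : Finset HexVertex), hexDomainSimplyConnected Λ → ∀ (u w : HexVertex), hexGraph.Adj u w → u ∉ Λ → w ∈ Λ → ∀ (n n' : ℤ) (x : ℂ) (r : ℝ), innerNormal k' ≠ innerNormal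 k → innerNormal k' ≠ -innerNormal k → ((∀ v : HexVertex, hexCenter v ∈ Metric.ball x r → (v ∈ Λ ↔ (n ≤ zigzagForm k v ∧ n' ≤ zigzagForm k' v))) ∨ (∀ v : HexVertex, hexCenter v ∈ Metric.ball x r → (v ∈ Λ ↔ (n ≤ zigzagForm k v ∨ n' ≤ zigzagForm k' v)))) → (∃ v₀ : HexVertex, hexCenter v₀ ∈ Metric.ball x (r - 7) ∧ zigzagForm k v₀ = n ∧ zigzagForm k' v₀ = n') → hexMidpoint s(u, w) ∉ Metric.ball x r → ∀ (v t v' t' : HexVertex), v ∈ Λ → t ∉ Λ → hexGraph.Adj v t → v' ∈ Λ → t' ∉ Λ → hexGraph.Adj v' t' → hexCenter t - hexCenter v = -((1 / Real.sqrt 3 : ℝ) : ℂ) * innerNormal k → hexCenter t' - hexCenter v' = -((1 / Real.sqrt 3 : ℝ) : ℂ) * innerNormal k' → hexMidpoint s(v, t) ∈ Metric.ball x (r - 4) → hexMidpoint s(v', t') ∈ Metric.ball x (r - 4) → hexParafermionicObservable Λ s(u, w) hexCriticalFugacity (5 / 8) s(v', t') * ((‖hexParafermionicObservable Λ s(u,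 w) hexCriticalFugacity 0 s(v, t)‖ : ℝ) : ℂ) = Complex.exp (-(5 / 8 : ℂ) * (Complex.arg (innerNormal k' / innerNormal k) : ℂ) * Complex.I) * hexParafermionicObservable Λ s(u, w) hexCriticalFugacity (5 / 8) s(v, t) * ((‖hexParafermionicObservable Λ s(u, w) hexCriticalFugacity 0 s(v', t')‖ : ℝ) : ℂ) := by
  intro Λ hΛ u w huw hu hw n n' x r hne hne' hpin hapex hroot v t v' t' hv ht hvt hv' ht' hvt' hdir hdir'
    heb heb'
  have hpin' : (∀ f : HexVertex, hexCenter f ∈ Metric.ball x r →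
      (f ∈ Λ ↔ (n' ≤ zigzagForm k' f ∧ n ≤ zigzagForm k f))) ∨ (∀ f : HexVertex,
      hexCenter f ∈ Metric.ball x r → (f ∈ Λ ↔ (n' ≤ zigzagForm k' f ∨ n ≤ zigzagForm k f))) :=
    hpin.imp (fun h f hf => (h f hf).trans and_comm) (fun h f hf => (h f hf).trans or_comm)
  have hapex' : ∃ v₀ : HexVertex, hexCenter v₀ ∈ Metric.ball x (r - 7) ∧ zigzagForm k' v₀ = n' ∧
      zigzagForm k v₀ = n := by
    obtain ⟨v₀, h, h1, h2⟩ := hapex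
    exact ⟨v₀, h, h2, h1⟩
  have key := IH Λ hΛ u w huw hu hw n' n x r hne.symm (fun h => hne' (by rw [h, neg_neg])) hpin' hapex'
    hroot v' t' v t hv' ht' hvt' hv ht hvt hdir' hdir heb' heb
  -- `arg (n_k / n_{k'}) = -arg (n_{k'} / n_k)`
  have hk0 : innerNormal k ≠ 0 := fun h => by simpa [h] using norm_innerNormal k
  have hk'0 : innerNormal k' ≠ 0 := fun h => by simpa [h] using norm_innerNormal k'
  have hnorm : ‖innerNormal k' / innerNormal k‖ = 1 := by
    rw [norm_div, norm_innerNormal, norm_innerNormal, div_one]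
  have hpi : Complex.arg (innerNormal k' / innerNormal k) ≠ Real.pi := by
    intro h
    have e := Complex.norm_mul_exp_arg_mul_I (innerNormal k' / innerNormal k)
    rw [hnorm, h, Complex.ofReal_one, one_mul, Complex.exp_pi_mul_I, eq_div_iff hk0] at e
    exact hne' (by rw [← e]; ring)
  have harg : Complex.arg (innerNormal k / innerNormal k') = -Complex.arg (innerNormal k' / innerNormal k) := by
    rw [← inv_div, Complex.arg_inv, if_neg hpi]
  rw [harg] at key
  -- invert the phase
  have hEE : Complex.exp (-(5 / 8 : ℂ) * (Complex.arg (innerNormal k' / innerNormal k) : ℂ) * Complex.I) *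
      Complex.exp (-(5 / 8 : ℂ) * ((-Complex.arg (innerNormal k' / innerNormal k) : ℝ) : ℂ) * Complex.I) = 1 := by
    rw [← Complex.exp_add, Complex.ofReal_neg]
    ring_nf
    exact Complex.exp_zero
  have hE0 : Complex.exp (-(5 / 8 : ℂ) * (Complex.arg (innerNormal k' / innerNormal k) : ℂ) * Complex.I) ≠ 0 :=
    Complex.exp_ne_zero _
  rw [eq_inv_of_mul_eq_one_right hEE] at key
  rw [mul_assoc, key, ← mul_assoc, ← mul_assoc, mul_inv_cancel₀ hE0, one_mul]

/-! ### 4. All pairs of forms -/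

/-- **The corner phase relation for every admissible pair of forms** (`ρ` is a `6`-cycle: induction
along `ρ^m k = 0`, the base `k = 0` being the two base files, a transport and the swaps).
[cite: DuminilCopinSmirnov2012, §3 (winding of walks to the boundary)] -/
theorem all_pairs : ∀ (k k' : Fin 6), ∀ (Λ : Finset HexVertex), hexDomainSimplyConnected Λ → ∀ (u w : HexVertex), hexGraph.Adj u w → u ∉ Λ → w ∈ Λ → ∀ (n n' : ℤ) (x : ℂ) (r : ℝ), innerNormal k' ≠ innerNormal k → innerNormal k' ≠ -innerNormal k → ((∀ v : HexVertex, hexCenter v ∈ Metric.ball x r → (v ∈ Λ ↔ (n ≤ zigzagForm k v ∧ n' ≤ zigzagForm k' v))) ∨ (∀ v : HexVertex, hexCenter v ∈ Metric.ball x r → (v ∈ Λ ↔ (n ≤ zigzagForm k v ∨ n' ≤ zigzagForm k' v)))) → (∃ v₀ : HexVertex, hexCenter v₀ ∈ Metric.ball x (r - 7) ∧ zigzagForm k v₀ = n ∧ zigzagForm k' v₀ = n') → hexMidpoint s(u, w) ∉ Metric.ball x r → ∀ (v t v' t' : HexVertex), v ∈ Λ → t ∉ Λ → hexGraph.Adj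 v t → v' ∈ Λ → t' ∉ Λ → hexGraph.Adj v' t' → hexCenter t - hexCenter v = -((1 / Real.sqrt 3 : ℝ) : ℂ) * innerNormal k → hexCenter t' - hexCenter v' = -((1 / Real.sqrt 3 : ℝ) : ℂ) * innerNormal k' → hexMidpoint s(v, t) ∈ Metric.ball x (r - 4) → hexMidpoint s(v', t') ∈ Metric.ball x (r - 4) → hexParafermionicObservable Λ s(u, w) hexCriticalFugacity (5 / 8) s(v', t') * ((‖hexParafermionicObservable Λ s(u, w) hexCriticalFugacity 0 s(v, t)‖ : ℝ) : ℂ) = Complex.exp (-(5 / 8 : ℂ) * (Complex.arg (innerNormal k' / innerNormal k) : ℂ) * Complex.I) * hexParafermionicObservable Λ s(u, w) hexCriticalFugacity (5 / 8) s(v, t) * ((‖hexParafermionicObservable Λ s(u, w) hexCriticalFugacity 0 s(v', t')‖ : ℝ) : ℂ) := by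
  have base : ∀ k' : Fin 6, ∀ (Λ : Finset HexVertex), hexDomainSimplyConnected Λ → ∀ (u w : HexVertex), hexGraph.Adj u w → u ∉ Λ → w ∈ Λ → ∀ (n n' : ℤ) (x : ℂ) (r : ℝ), innerNormal k' ≠ innerNormal 0 → innerNormal k' ≠ -innerNormal 0 → ((∀ v : HexVertex, hexCenter v ∈ Metric.ball x r → (v ∈ Λ ↔ (n ≤ zigzagForm 0 v ∧ n' ≤ zigzagForm k' v))) ∨ (∀ v : HexVertex, hexCenter v ∈ Metric.ball x r → (v ∈ Λ ↔ (n ≤ zigzagForm 0 v ∨ n' ≤ zigzagForm k' v)))) → (∃ v₀ : HexVertex, hexCenter v₀ ∈ Metric.ball x (r - 7) ∧ zigzagForm 0 v₀ = n ∧ zigzagForm k' v₀ = n') → hexMidpoint s(u, w) ∉ Metric.ball x r → ∀ (v t v' t' : HexVertex), v ∈ Λ → t ∉ Λ → hexGraph.Adj v t → v' ∈ Λ → t' ∉ Λ → hexGraph.Adj v' t' → hexCenter t - hexCenter v = -((1 / Real.sqrt 3 : ℝ) : ℂ) * innerNormal 0 → hexCenter t' - hexCenter v' = -((1 / Real.sqrt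 3 : ℝ) : ℂ) * innerNormal k' → hexMidpoint s(v, t) ∈ Metric.ball x (r - 4) → hexMidpoint s(v', t') ∈ Metric.ball x (r - 4) → hexParafermionicObservable Λ s(u, w) hexCriticalFugacity (5 / 8) s(v', t') * ((‖hexParafermionicObservable Λ s(u, w) hexCriticalFugacity 0 s(v, t)‖ : ℝ) : ℂ) = Complex.exp (-(5 / 8 : ℂ) * (Complex.arg (innerNormal k' / innerNormal 0) : ℂ) * Complex.I) * hexParafermionicObservable Λ s(u, w) hexCriticalFugacity (5 / 8) s(v, t) * ((‖hexParafermionicObservable Λ s(u, w) hexCriticalFugacity 0 s(v', t')‖ : ℝ) : ℂ) := by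
    intro k'
    fin_cases k'
    · intro Λ _ u w _ _ _ n n' x r hne
      exact absurd rfl hne
    · intro Λ _ u w _ _ _ n n' x r _ hne'
      exact absurd (by rw [innerNormal_eq]; simp) hne'
    · exact sidePhaseCorner_base_two
    · exact sidePhaseCorner_base_three
    · exact swap (transport sidePhaseCorner_base_three)
    · exact swap (transport (transport (transport (transport sidePhaseCorner_base_two))))
  suffices H : ∀ (m : ℕ) (k k' : Fin 6), ((![3, 2, 4, 5, 0, 1] : Fin 6 → Fin 6)^[m]) k = 0 → ∀ (Λ : Finset HexVertex), hexDomainSimplyConnected Λ → ∀ (u w : HexVertex), hexGraph.Adj u w → u ∉ Λ → w ∈ Λ → ∀ (n n' : ℤ) (x : ℂ) (r : ℝ), innerNormal k' ≠ innerNormal k → innerNormal k' ≠ -innerNormal k → ((∀ v : HexVertex, hexCenter v ∈ Metric.ball x r → (v ∈ Λ ↔ (n ≤ zigzagForm k v ∧ n' ≤ zigzagForm k' v))) ∨ (∀ v : HexVertex, hexCenter v ∈ Metric.ball x r → (v ∈ Λ ↔ (n ≤ zigzagForm k v ∨ n' ≤ zigzagForm k' v)))) → (∃ v₀ : HexVertex,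 hexCenter v₀ ∈ Metric.ball x (r - 7) ∧ zigzagForm k v₀ = n ∧ zigzagForm k' v₀ = n') → hexMidpoint s(u, w) ∉ Metric.ball x r → ∀ (v t v' t' : HexVertex), v ∈ Λ → t ∉ Λ → hexGraph.Adj v t → v' ∈ Λ → t' ∉ Λ → hexGraph.Adj v' t' → hexCenter t - hexCenter v = -((1 / Real.sqrt 3 : ℝ) : ℂ) * innerNormal k → hexCenter t' - hexCenter v' = -((1 / Real.sqrt 3 : ℝ) : ℂ) * innerNormal k' → hexMidpoint s(v, t) ∈ Metric.ball x (r - 4) → hexMidpoint s(v', t') ∈ Metric.ball x (r - 4) → hexParafermionicObservable Λ s(u, w) hexCriticalFugacity (5 / 8) s(v', t') * ((‖hexParafermionicObservable Λ s(u, w) hexCriticalFugacity 0 s(v, t)‖ : ℝ) : ℂ) = Complex.exp (-(5 / 8 : ℂ) * (Complex.arg (innerNormal k' / innerNormal k) : ℂ) * Complex.I) * hexParafermionicObservable Λ s(u, w) hexCriticalFugacity (5 / 8) s(v, t) * ((‖hexParafermionicObservable Λ s(u, w) hexCriticalFugacity 0 s(v', t')‖ : ℝ) : ℂ) by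
    intro k k'
    fin_cases k
    · exact H 0 _ _ (by decide)
    · exact H 3 _ _ (by decide)
    · exact H 2 _ _ (by decide)
    · exact H 5 _ _ (by decide)
    · exact H 1 _ _ (by decide)
    · exact H 4 _ _ (by decide)
  intro m
  induction m with
  | zero =>
    intro k k' hk
    rw [Function.iterate_zero, id_eq] at hk
    subst hk
    exact base k'
  | succ m ih =>
    intro k k' hk
    rw [Function.iterate_succ_apply] at hk
    exact transport (ih _ _ hk)

end SidePhaseCorner

/-! ### 5. The registered sub-goal (corrected statement) -/

/-- **SUB-GOAL `sidePhase_corner` ((A1b') of `stub_polygonIdentification`, line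
`polygon-parity-squeeze`, crux stmt-CriticalPhenomena-14004), corrected form: the phases of the two
dart classes at an exact lattice corner differ by `e^{-i(5/8)T}`, `T = arg (n_{k'}/n_k)`.**
For a simply connected `Λ` rooted at the boundary dart `{u, w}`, which inside `ball x r` is the
exact convex (`∧`) or reflex (`∨`) corner of the half-lattices `{n ≤ zigzagForm k}`,
`{n' ≤ zigzagForm k'}` (normals neither equal nor opposite) WITH THE CORNER FACE (a face on both
threshold zigzags) IN `ball x (r - 7)`, the root midpoint outside `ball x r`: a dart `{v, t}`
heading `-(1/√3) n_k` and a dart `{v', t'}` heading `-(1/√3) n_{k'}`, both with midpoints in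
`ball x (r - 4)`, satisfy `F(e')·|F₀(e)| = e^{-i(5/8)·arg(n_{k'}/n_k)} F(e)·|F₀(e')|`.
[cite: DuminilCopinSmirnov2012, §3 (winding of walks to the boundary)] -/
theorem sidePhase_corner : ∀ (Λ : Finset HexVertex), hexDomainSimplyConnected Λ → ∀ (u w : HexVertex), hexGraph.Adj u w → u ∉ Λ → w ∈ Λ → ∀ (k k' : Fin 6) (n n' : ℤ) (x : ℂ) (r : ℝ), innerNormal k' ≠ innerNormal k → innerNormal k' ≠ -innerNormal k → ((∀ v : HexVertex, hexCenter v ∈ Metric.ball x r → (v ∈ Λ ↔ (n ≤ zigzagForm k v ∧ n' ≤ zigzagForm k' v))) ∨ (∀ v : HexVertex, hexCenter v ∈ Metric.ball x r → (v ∈ Λ ↔ (n ≤ zigzagForm k v ∨ n' ≤ zigzagForm k' v)))) → (∃ v₀ : HexVertex, hexCenter v₀ ∈ Metric.ball x (r - 7) ∧ zigzagForm k v₀ = n ∧ zigzagForm k' v₀ = n') → hexMidpoint s(u, w) ∉ Metric.ball x r → ∀ (v t v' t' : HexVertex), v ∈ Λ → t ∉ Λ → hexGraph.Adj v t → v' ∈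 Λ → t' ∉ Λ → hexGraph.Adj v' t' → hexCenter t - hexCenter v = -((1 / Real.sqrt 3 : ℝ) : ℂ) * innerNormal k → hexCenter t' - hexCenter v' = -((1 / Real.sqrt 3 : ℝ) : ℂ) * innerNormal k' → hexMidpoint s(v, t) ∈ Metric.ball x (r - 4) → hexMidpoint s(v', t') ∈ Metric.ball x (r - 4) → hexParafermionicObservable Λ s(u, w) hexCriticalFugacity (5 / 8) s(v', t') * ((‖hexParafermionicObservable Λ s(u, w) hexCriticalFugacity 0 s(v, t)‖ : ℝ) : ℂ) = Complex.exp (-(5 / 8 : ℂ) * (Complex.arg (innerNormal k' / innerNormal k) : ℂ) * Complex.I) * hexParafermionicObservable Λ s(u, w) hexCriticalFugacity (5 / 8) s(v, t) * ((‖hexParafermionicObservable Λ s(u, w) hexCriticalFugacity 0 s(v', t')‖ : ℝ) : ℂ) :=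
  fun Λ hΛ u w huw hu hw k k' => SidePhaseCorner.all_pairs k k' Λ hΛ u w huw hu hw

end Summit.CriticalPhenomena.SAWScalingLimit.Theorems.PolygonParitySqueeze

end
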